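import Literature.AlgebraicGeometry.Resolution.AffineBlowupCartier

/-!
# `FibrewiseClosedPoints` — negative lemmas II: one-chart blowing ups (plumbing)

Support (negative) lemmas for crux `stmt-ResolutionOfSingularities-15960`
(`Summit.ResolutionOfSingularities.ResolutionOfSingularities.Theses.SectionAscent.FibrewiseClosedPoints`),
filed by the refuter's crux attack (2026-08-17); used by `AlmostNormalization.lean` to show that the
route's intermediate predicate `Almost` holds for EVERY affine domain of finite type over a field
(its blowing up there is the finite normalisation). This file declares NO definition and mentions
no route decl; everything is stated for a general ideal `J` of a commutative ring `R` and `c ∈ J`.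

* `reesT_pow_mem_span_reesT` — a relation `b ^ n = ∑_{i<n} p_i c^{n-i} b^i` in `R` (integral
  dependence of `b/c`) gives `(bt)^n ∈ (ct)` in the Rees algebra `R[Jt]`.
* `basicOpen_reesT_eq_top` — **one chart suffices**: if every `b ∈ J` satisfies such a relation,
  `D₊(ct) = Proj R[Jt] = Bl_J(Spec R)` (a relevant homogeneous prime containing `ct` would contain
  every `bt`, hence the irrelevant ideal).
* `isIso_chartι_of_basicOpen_eq_top` — then the chart immersion
  `Spec (R[Jt])_{(ct)} → Bl_J(Spec R)` is an isomorphism.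
* `isIntegrallyClosed_stalk_of_isIso_chartι` — if moreover the chart ring is an integrally closed
  domain, every local ring of `Bl_J(Spec R)` is integrally closed.
* `π_chartι_apply`, `not_specializes_of_isIso_chartι` — on the chart `π` is `Spec` of
  `R → (R[Jt])_{(ct)}`; if that ring map is integral, no point of `Bl_J(Spec R)` has a proper
  specialisation inside its fibre (incomparability, Mathlib
  `Ideal.comap_lt_comap_of_integral_mem_sdiff`).

## Sources
* The Stacks Project, Tag 0804 (affine blowup algebras and the charts `D₊(a t)`), Tag 00GT
  (incomparability for integral ring maps); Q. Liu, *Algebraic Geometry and Arithmetic Curves*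
  (2002), Lemma 8.3.47 (a) (the statement these lemmas serve).
-/

noncomputable section

set_option linter.dupNamespace false -- mandated namespace of this single-conjunct summit

open CategoryTheory AlgebraicGeometry TopologicalSpace Polynomial HomogeneousLocalization
open Literature.AlgebraicGeometry.Resolution

namespace Summit.ResolutionOfSingularities.ResolutionOfSingularities.Theorems.FibrewiseClosedPoints.Negative

universe u

/-! ## Blowing up an ideal of "fractions with a fixed denominator": one chart suffices -/

/-- If `b ^ n = ∑_{i<n} p_i c^{n-i} b^i` in `R` (an integral dependence relation of `b/c` over `R`,
cleared of denominators), then `(bt)^n` lies in the ideal of `R[Jt]` generated by `ct`.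
[folklore] -/
theorem reesT_pow_mem_span_reesT {R : Type u} [CommRing R] {J : Ideal R} {b c : R} (hb : b ∈ J)
    (hc : c ∈ J) {n : ℕ} {p : ℕ → R}
    (hrel : b ^ n = ∑ i ∈ Finset.range n, p i * c ^ (n - i) * b ^ i) :
    reesT b hb ^ n ∈ Ideal.span {reesT (I := J) c hc} := by
  -- the same relation holds between `bt` and `ct` in `R[t]`, inside `R[Jt]`
  have key : reesT b hb ^ n = ∑ i ∈ Finset.range n,
      algebraMap R (reesAlgebra J) (p i) * reesT c hc ^ (n - i) * reesT b hb ^ i := by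
    apply Subtype.ext
    simp only [SubmonoidClass.coe_pow, coe_reesT, AddSubmonoidClass.coe_finsetSum,
      Subalgebra.coe_mul, Subalgebra.coe_algebraMap, ← Polynomial.C_eq_algebraMap,
      monomial_pow, C_mul_monomial, monomial_mul_monomial]
    have hdeg : ∀ i ∈ Finset.range n, 1 * (n - i) + 1 * i = 1 * n := by
      intro i hi
      rw [Finset.mem_range] at hi
      omega
    rw [Finset.sum_congr rfl fun i hi => by rw [hdeg i hi], ← map_sum (monomial (1 * n)), ← hrel]
  rw [key]
  refine Ideal.sum_mem _ fun i hi => ?_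
  rw [Finset.mem_range] at hi
  obtain ⟨k, hk⟩ : ∃ k, n - i = k + 1 := ⟨n - i - 1, by omega⟩
  rw [hk, pow_succ]
  exact Ideal.mul_mem_right _ _ (Ideal.mul_mem_left _ _
    (Ideal.mul_mem_left _ _ (Ideal.subset_span rfl)))

/-- **One chart suffices.** If every `b ∈ J` satisfies a relation `b ^ n = ∑_{i<n} p_i c^{n-i} b^i`
(`b/c` integral over `R`) for a fixed `c ∈ J`, then the chart `D₊(ct)` is the whole blowing up
`Bl_J(Spec R) = Proj R[Jt]`: a relevant homogeneous prime containing `ct` would contain every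
`(bt)^n`, hence every `bt`, hence the irrelevant ideal. [folklore] -/
theorem basicOpen_reesT_eq_top {R : Type u} [CommRing R] {J : Ideal R} {c : R} (hc : c ∈ J)
    (hint : ∀ b ∈ J, ∃ (n : ℕ) (p : ℕ → R), b ^ n = ∑ i ∈ Finset.range n, p i * c ^ (n - i) * b ^ i) :
    Proj.basicOpen (reesGrading J) (reesT c hc) = ⊤ := by
  rw [eq_top_iff]
  rintro x -
  rw [Proj.mem_basicOpen]
  intro hx
  apply x.not_irrelevant_le
  intro z hz
  have hz' := irrelevant_le_span_reesT J hz
  have hle : Ideal.span (Set.range fun b : J => reesT (I := J) b.1 b.2) ≤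
      x.asHomogeneousIdeal.toIdeal := by
    rw [Ideal.span_le]
    rintro _ ⟨⟨b, hb⟩, rfl⟩
    obtain ⟨n, p, hrel⟩ := hint b hb
    have hpow : reesT b hb ^ n ∈ x.asHomogeneousIdeal.toIdeal :=
      (Ideal.span_singleton_le_iff_mem _ |>.mpr hx) (reesT_pow_mem_span_reesT hb hc hrel)
    exact x.isPrime.mem_of_pow_mem n hpow
  exact hle hz'

/-- Hence the chart immersion `Spec (R[Jt])_{(ct)} → Bl_J(Spec R)` is an isomorphism. [folklore] -/
theorem isIso_chartι_of_basicOpen_eq_top {R : Type u} [CommRing R] {J : Ideal R} {c : R} (hc : c ∈ J)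
    (htop : Proj.basicOpen (reesGrading J) (reesT c hc) = ⊤) :
    IsIso (affineBlowup.chartι (I := J) c hc) := by
  have hsurj : Function.Surjective (affineBlowup.chartι (I := J) c hc).base := by
    intro x
    have hx : x ∈ (affineBlowup.chartι (I := J) c hc ''ᵁ ⊤ : (affineBlowup J).Opens) := by
      rw [affineBlowup.image_top_chartι, htop]; trivial
    obtain ⟨y, -, hy⟩ := hx
    exact ⟨y, hy⟩
  haveI : Epi (affineBlowup.chartι (I := J) c hc).base := (TopCat.epi_iff_surjective _).mpr hsurj
  exact IsOpenImmersion.isIso _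

/-! ## Consequences of "one chart suffices" for the stalks and the fibres of the blowing up -/

/-- If the chart `D₊(ct)` is everything and the chart ring `(R[Jt])_{(ct)}` is an integrally closed
domain, every local ring of `Bl_J(Spec R)` is integrally closed. [folklore] -/
theorem isIntegrallyClosed_stalk_of_isIso_chartι {R : Type u} [CommRing R] {J : Ideal R} {c : R}
    (hc : c ∈ J) [IsIso (affineBlowup.chartι (I := J) c hc)]
    [IsDomain (Away (reesGrading J) (reesT c hc))]
    [IsIntegrallyClosed (Away (reesGrading J) (reesT c hc))] (y : affineBlowup J) :
    IsIntegrallyClosed ((affineBlowup J).presheaf.stalk y) := by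
  let e := asIso (affineBlowup.chartι (I := J) c hc)
  have hy : e.hom.base (e.inv.base y) = y := Scheme.inv_hom_apply e y
  letI : Algebra (Away (reesGrading J) (reesT c hc))
      ((Spec (.of (Away (reesGrading J) (reesT c hc)))).presheaf.stalk (e.inv.base y)) :=
    inferInstanceAs (Algebra (Away (reesGrading J) (reesT c hc))
      ((Spec.structureSheaf (Away (reesGrading J) (reesT c hc))).presheaf.stalk (e.inv.base y)))
  haveI : IsLocalization.AtPrime
      ((Spec (.of (Away (reesGrading J) (reesT c hc)))).presheaf.stalk (e.inv.base y))
      (e.inv.base y).asIdeal :=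
    StructureSheaf.IsLocalization.to_stalk (Away (reesGrading J) (reesT c hc)) (e.inv.base y)
  haveI : IsIntegrallyClosed
      ((Spec (.of (Away (reesGrading J) (reesT c hc)))).presheaf.stalk (e.inv.base y)) :=
    isIntegrallyClosed_of_isLocalization _ (e.inv.base y).asIdeal.primeCompl
      (Ideal.primeCompl_le_nonZeroDivisors _)
  have h := IsIntegrallyClosed.of_equiv
    (asIso (e.hom.stalkMap (e.inv.base y))).commRingCatIsoToRingEquiv.symm
  rwa [hy] at h

/-- On the chart, `π` is `Spec` of the structure map `R → (R[Jt])_{(ct)}`, pointwise. [folklore] -/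
theorem π_chartι_apply {R : Type u} [CommRing R] {J : Ideal R} {c : R} (hc : c ∈ J)
    (w : Spec (.of (Away (reesGrading J) (reesT c hc)))) :
    (affineBlowup.π J).base ((affineBlowup.chartι (I := J) c hc).base w) =
      PrimeSpectrum.comap (reesChartBase (I := J) c hc) w := by
  rw [← Scheme.Hom.comp_apply, affineBlowup.chartι_π, Spec.map_apply]
  rfl

/-- If the chart `D₊(ct)` is everything and the chart ring is integral over `R`, no point of
`Bl_J(Spec R)` has a proper specialisation inside its fibre over `Spec R` (incomparability for
integral extensions). [folklore] -/
theorem not_specializes_of_isIso_chartι {R : Type u} [CommRing R] {J : Ideal R} {c : R}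
    (hc : c ∈ J) [IsIso (affineBlowup.chartι (I := J) c hc)]
    (hint : (reesChartBase (I := J) c hc).IsIntegral) {y z : affineBlowup J} (hyz : y ⤳ z)
    (hne : z ≠ y) (hπ : (affineBlowup.π J).base z = (affineBlowup.π J).base y) : False := by
  let e := asIso (affineBlowup.chartι (I := J) c hc)
  have hy : e.hom.base (e.inv.base y) = y := Scheme.inv_hom_apply e y
  have hz : e.hom.base (e.inv.base z) = z := Scheme.inv_hom_apply e z
  have hyz' : e.inv.base y ⤳ e.inv.base z := hyz.map e.inv.base.hom.continuous
  have hne' : e.inv.base z ≠ e.inv.base y := fun h => hne (by rw [← hy, ← hz, h])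
  have hπ' : PrimeSpectrum.comap (reesChartBase (I := J) c hc) (e.inv.base y) =
      PrimeSpectrum.comap (reesChartBase (I := J) c hc) (e.inv.base z) := by
    rw [← π_chartι_apply hc, ← π_chartι_apply hc]
    change (affineBlowup.π J).base (e.hom.base (e.inv.base y)) =
      (affineBlowup.π J).base (e.hom.base (e.inv.base z))
    rw [hy, hz, hπ]
  have hle : (e.inv.base y).asIdeal ≤ (e.inv.base z).asIdeal :=
    (PrimeSpectrum.le_iff_specializes _ _).mpr hyz'
  have hlt : (e.inv.base y).asIdeal < (e.inv.base z).asIdeal :=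
    lt_of_le_of_ne hle fun h => hne' (PrimeSpectrum.ext h.symm)
  obtain ⟨x, hxz, hxy⟩ := SetLike.exists_of_lt hlt
  letI := (reesChartBase (I := J) c hc).toAlgebra
  have hcomap := Ideal.comap_lt_comap_of_integral_mem_sdiff (R := R) hle ⟨hxz, hxy⟩ (hint x)
  have heq : (e.inv.base y).asIdeal.comap (reesChartBase (I := J) c hc) =
      (e.inv.base z).asIdeal.comap (reesChartBase (I := J) c hc) := by
    have := congrArg PrimeSpectrum.asIdeal hπ'
    simpa only [PrimeSpectrum.comap_asIdeal] using this
  exact absurd heq (ne_of_lt hcomap)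


end Summit.ResolutionOfSingularities.ResolutionOfSingularities.Theorems.FibrewiseClosedPoints.Negative

end
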